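import Literature.Geometry.Kaehler.ComplexTorusIntegralLefschetzFormsDiscriminant
import Literature.Geometry.Kaehler.ComplexTorusIntegralLefschetzDecompositionDegreeTwo
import Literature.Geometry.Kaehler.ComplexTorusHardLefschetzMinimalClassModPrimeImage
import Literature.Topology.FourManifolds.LatticeFormsPrimitiveSublatticeDiscriminant
import Mathlib.GroupTheory.IndexNSmul
import HarnessLib

/-!
# The Lefschetz form of degree two on the primitive lattice `P²(X, ℤ)`: `H²(X, ℤ) ⊇ ℤ·θ ⊥ P²(X, ℤ)` is a
# `B₂`-orthogonal splitting of index `g·d_g`, `B₂(θ, θ) = ±g(g−1)·d_{g−1}d_g`, and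
# `|disc B₂|_{P²(X, ℤ)}| · d_{g−1} = g · d_g · ∏_{i ≤ g−2} ((d_{g−1}/d_i)(d_g/d_i))^{2g−1}`

Layer `Literature/Geometry/Kaehler`, namespace `Literature.Geometry.Kaehler.ComplexTorus`; lane `lit-hodgefound` (Track 2
foundations library), seat p09, generation 42, row g42-#8. THEOREMS ONLY (0 definitions); no named fact, net debt 0. Sequel of
g41-#1 `ComplexTorusIntegralLefschetzFormsDiscriminant` (`|disc B₂| = (g−1)·∏_{i ≤ g−2} ((d_{g−1}/d_i)(d_g/d_i))^{2g−1}` on `H²(X, ℤ)`),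
g40 `ComplexTorusIntegralLefschetzDecompositionDegreeTwo` (`[H²(X, ℤ) : ℤ·θ ⊕ P²(X, ℤ)] = g·d_g`) and the lane's lattice file
`Topology/FourManifolds/LatticeFormsPrimitiveSublatticeDiscriminant` (Huybrechts' (0.2):
`disc Λ₁ · disc Λ₁^⊥ = disc Λ · (Λ : Λ₁ ⊕ Λ₁^⊥)²` for any symmetric integral form).

THE SETTING. `X = E/Φ(ℤ^ι)` a complex torus with a Riemann form `η` of type `(d₁, …, d_g)` on the lattice (`IsPolarizationType Φ η d`, ANY
presentation), `g = j + 2`, `θ = ofRealForm η ∈ H²(X, ℤ)`, `γ = γ_{g−2}` the integral minimal class (`θ^{∧(g−2)} = ((g−2)!·d₁⋯d_{g−2})·γ`),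
`B₂(x, y) = ⟨x, γ ∧ y⟩_e` the integral Lefschetz form of degree two (symmetric, g41-#3), and
`P²(X, ℤ) = H²(X, ℤ) ∩ ker(θ^{∧(g−1)} ∧ (−))` the integral primitive lattice (Lange §5.4.1 "`H^r_pr(M, ℤ) := H^r_pr(M, ℂ) ∩ H^r_ℤ(M)`",
Voisin §6.2.3: `H²(X)_prim = Ker L^{g−1}`).

THE RESULTS.

* §1 `(j!·d₁⋯d_j) · B₂(θ, y) = sign_X(e) · ∫_X θ^{∧(g−1)} ∧ y` for every `2`-form `y`; hence **`B₂(θ, y) = 0 ⟺ θ^{∧(g−1)} ∧ y = 0`**: the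
  primitive classes are exactly the `B₂`-orthogonal complement of the polarisation, `P²(X, ℤ) = θ^{⊥_{B₂}} ∩ H²(X, ℤ)` (over `ℚ` this is the
  Hodge–Riemann orthogonality of the Lefschetz decomposition `H² = ℂθ ⊕ P²`); and
  **`sign_X(e) · B₂(θ, θ) = (−1)^g · g(g−1) · d_{g−1} d_g`** (`∫_X θ^{∧g} = (−1)^g g!·d₁⋯d_g`, Riemann–Roch / Lemma 1.7.5); in particular
  `B₂(θ, θ) ≠ 0` and `ℤθ ∩ P²(X, ℤ) = 0`.
* §2 **The discriminant of `B₂` on the primitive lattice.** For every `ℤ`-basis `c` of `P²(X, ℤ)` and the integer Gram matrix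
  `G_P = (⟨c_i, γ ∧ c_{i'}⟩)`:

    `|det G_P| · d_{g−1} = g · d_g · ∏_{i=1}^{g−2} ((d_{g−1}/d_i)·(d_g/d_i))^{2g−1}`,

  from Huybrechts' (0.2) `B₂(θ, θ) · det G_P = [H² : ℤθ ⊕ P²]² · det G_{H²}` with `[H² : ℤθ ⊕ P²] = g·d_g` (g40) and `|det G_{H²}| =
  (g−1)·∏((d_{g−1}/d_i)(d_g/d_i))^{2g−1}` (g41-#1). For a principal polarisation: **`|disc B₂|_{P²(X, ℤ)}| = g`** — for `g = 2` this is the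
  classical `θ^⊥ ≅ U ⊕ U ⊕ ⟨−2⟩` in `H²(X, ℤ) ≅ U³` of a principally polarised abelian surface, `|disc θ^⊥| = 2`.

Sources (the statements being made precise over `ℤ`): Lange 2023 §5.4.1 Thm. 5.4.1/5.4.2 and (5.22) (PDF p. 275: Lefschetz decomposition,
primitive cohomology, "`H^r_ℤ(M) = ⊕ Lˢ H^{r−2s}_pr(M, ℤ)`" up to finite index on an abelian variety), §6.2.4 (PDF p. 310: Poincaré
duality over `ℤ`), §1.7.2 Lemma 1.7.5 (PDF p. 73: `∫ (dd^c)… = g!·d₁⋯d_g`-type volume computation), §2.5.3 Thm. 2.5.16 / Cor. 2.5.17 (PDF p. 135);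
Voisin 2002 §6.2.3 Thm. 6.25 / Cor. 6.26 (PDF pp. 125–126) and §6.3.2 (Hodge–Riemann bilinear relations: the Lefschetz decomposition is
orthogonal for `∫ L^{n−k} α ∧ β`), §7.1.2 (PDF p. 134 L31); Huybrechts 2016 Ch. 14 §0.1 (0.1)–(0.2) (discriminants of sublattices of finite
index and of orthogonal complements); Birkenhake–Lange / Lange 2023 §4.2 (PDF p. 204).

## References

* [cite: Lange2023AbelianVarietiesComplex, §5.4.1 Thm. 5.4.1, Thm. 5.4.2 and (5.22) (PDF p. 275); §6.2.4 (PDF p. 310); §1.7.2 Lemma 1.7.5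
  (PDF p. 73); §2.5.3 Thm. 2.5.16 and Cor. 2.5.17 (PDF p. 135); §1.5.1 (PDF p. 51); §2.1.1]
* [cite: VoisinHodgeI2002, §6.2.3 Thm. 6.25 and Cor. 6.26 (PDF pp. 125–126); §6.3.2; §7.1.2 (PDF p. 134 L31)]
* [cite: Huybrechts2016K3, Ch. 14 §0.1 (0.1)–(0.2)]
* [cite: ConwaySloane1999, Ch. 2 §2.4 (PDF p. 162)]
-/

noncomputable section

open Module Function
open LinearMap (BilinForm)
open Literature.LinearAlgebra.Alternating

namespace Literature.Geometry.Kaehler.ComplexTorus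

/-! ## §0 Private helpers -/

section Helpers

variable {ι : Type*} [Fintype ι] [DecidableEq ι] {E : Type*} [NormedAddCommGroup E] [NormedSpace ℂ E]
  (Φ : (ι → ℝ) ≃L[ℝ] E) {m n : ℕ}

omit [Fintype ι] in
/-- The orientation sign does not see a re-casting of `Fin`. [folklore] -/
private theorem orientationSign_finCongr_trans₅₈ (h : m = n) (e : Fin n ≃ ι) :
    orientationSign Φ ((finCongr h).trans e) = orientationSign Φ e := by
  subst h; rfl

/-- `∏_{a=1}^{j+2} d_a = (∏_{i ≤ j} d_i) · d_{j+1} · d_{j+2}`. [folklore] -/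
private theorem prod_univ_eq_prod_castLE_mul_mul₅₈ {j : ℕ} (d : Fin (j + 2) → ℕ) (hle : j ≤ j + 2) :
    ∏ i, (d i : ℂ) = (∏ i : Fin j, (d (Fin.castLE hle i) : ℂ)) * d (Fin.last j).castSucc * d (Fin.last (j + 1)) := by
  rw [Fin.prod_univ_castSucc, Fin.prod_univ_castSucc]
  rfl

end Helpers

/-! ## §1 `B₂(θ, ·)`: the primitive lattice is the `B₂`-orthogonal complement of `θ`, and `B₂(θ, θ) = ±g(g−1)d_{g−1}d_g` -/

section Orthogonal

variable {ι : Type*} [Fintype ι] [DecidableEq ι] {E : Type*} [NormedAddCommGroup E] [NormedSpace ℂ E]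
  {Φ : (ι → ℝ) ≃L[ℝ] E} {j n : ℕ} {η : E [⋀^Fin 2]→L[ℝ] ℝ} {d : Fin (j + 2) → ℕ}

variable (Φ) in
omit [Fintype ι] in
/-- **`(j!·d₁⋯d_j) · ⟨θ, γ_{g−2} ∧ y⟩_e = sign_X(e) · ∫_X θ^{∧(g−1)} ∧ y`** for every `2`-form `y` (`g = j + 2`, `θ^{∧j} = (j!·d₁⋯d_j)·γ`):
`⟨θ, γ ∧ y⟩ = ⟨y, γ ∧ θ⟩` (symmetry of the Lefschetz form of degree two), `(j!·d₁⋯d_j)·(γ ∧ θ) = θ^{∧(j+1)}`, and `⟨y, θ^{∧(j+1)}⟩ = ⟨θ^{∧(j+1)}, y⟩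
= sign_X(e) ∫ θ^{∧(j+1)} ∧ y` (even degrees commute). [cite: Lange2023AbelianVarietiesComplex, §6.2.4 (PDF p. 310); §2.5.3 Thm. 2.5.16 (PDF p. 135)] [cite: VoisinHodgeI2002, §6.3.2] -/
theorem content_mul_poincarePairing_ofRealForm_wedge_eq_orientationSign_mul_torusIntegral
    {γ : E [⋀^Fin (2 * j)]→L[ℝ] ℂ} {c : ℂ} (hγ : wedgePow (ofRealForm η) j = c • γ)
    (e : Fin n ≃ ι) (hn : 2 + (2 * j + 2) = n) (h' : 2 * j + 2 + 2 = n) (y : E [⋀^Fin 2]→L[ℝ] ℂ) :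
    c * poincarePairing Φ e hn (ofRealForm η) (γ.wedge y) =
      orientationSign Φ e * torusIntegral Φ ((finCongr h').trans e) ((wedgePow (ofRealForm η) (j + 1)).wedge y) := by
  have hcw : c • γ.wedge (ofRealForm η : E [⋀^Fin 2]→L[ℝ] ℂ) = wedgePow (ofRealForm η) (j + 1) := by
    rw [← wedge_smul_left_complex, ← hγ]; rfl
  have h1 : c * poincarePairing Φ e hn (ofRealForm η) (γ.wedge y) = poincarePairing Φ e hn y (wedgePow (ofRealForm η) (j + 1)) := by
    rw [poincarePairing_wedge_comm_of_two Φ e hn γ (ofRealForm η) y, ← hcw, map_smul, smul_eq_mul]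
  have h2 : poincarePairing Φ e hn y (wedgePow (ofRealForm η) (j + 1)) =
      poincarePairing Φ e h' (wedgePow (ofRealForm η) (j + 1)) y := by
    rw [poincarePairing_comm Φ e h' hn (wedgePow (ofRealForm η) (j + 1)) y, Even.neg_one_pow (even_two.mul_left _), one_mul]
  have h3 := torusIntegral_wedge_eq_orientationSign_mul_poincarePairing Φ e h' (wedgePow (ofRealForm η) (j + 1)) y
  have hs : ((orientationSign Φ ((finCongr h').trans e) : ℤ) : ℂ) * orientationSign Φ ((finCongr h').trans e) = 1 := by
    rw [← Int.cast_mul, orientationSign_mul_self, Int.cast_one]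
  have hsgn : ((orientationSign Φ ((finCongr h').trans e) : ℤ) : ℂ) = orientationSign Φ e :=
    congrArg (fun z : ℤ ↦ (z : ℂ)) (orientationSign_finCongr_trans₅₈ Φ h' e)
  rw [h1, h2, ← hsgn, h3, ← mul_assoc, hs, one_mul]

/-- **`⟨θ, γ_{g−2} ∧ y⟩_e = 0 ⟺ θ^{∧(g−1)} ∧ y = 0`** for every `2`-form `y` (`g = j + 2`; polarised torus of type `(d₁, …, d_g)`, any presentation,
any orientation): **the primitive classes `P² = ker(L^{g−1})` are exactly the `B₂`-orthogonal complement of the polarisation `θ`** — the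
integral shadow of the Hodge–Riemann orthogonality of the Lefschetz decomposition `H² = ℂθ ⊕ P²`. [cite: VoisinHodgeI2002, §6.2.3 Thm. 6.25 and Cor. 6.26 (PDF pp. 125–126); §6.3.2] [cite: Lange2023AbelianVarietiesComplex, §5.4.1 Thm. 5.4.2 and (5.22) (PDF p. 275); §6.2.4 (PDF p. 310)] -/
theorem IsPolarizationType.poincarePairing_ofRealForm_wedge_eq_zero_iff_of_eq_content_smul (hd : IsPolarizationType Φ η d)
    (hη : IsRiemannForm Φ η) (hle : j ≤ j + 2) {γ : E [⋀^Fin (2 * j)]→L[ℝ] ℂ}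
    (hγ : wedgePow (ofRealForm η) j = ((j.factorial * ∏ i : Fin j, d (Fin.castLE hle i) : ℕ) : ℂ) • γ)
    (e : Fin n ≃ ι) (hn : 2 + (2 * j + 2) = n) (y : E [⋀^Fin 2]→L[ℝ] ℂ) :
    poincarePairing Φ e hn (ofRealForm η) (γ.wedge y) = 0 ↔ (wedgePow (ofRealForm η) (j + 1)).wedge y = 0 := by
  have h' : 2 * j + 2 + 2 = n := by omega
  have hc : ((j.factorial * ∏ i : Fin j, d (Fin.castLE hle i) : ℕ) : ℂ) ≠ 0 :=
    Nat.cast_ne_zero.2 (Nat.mul_ne_zero (Nat.factorial_ne_zero _) (Finset.prod_ne_zero_iff.2 fun i _ ↦ (hd.pos hη _).ne'))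
  have hs : (orientationSign Φ e : ℂ) ≠ 0 := by
    rcases orientationSign_eq_or Φ e with h | h <;> rw [h] <;> norm_num
  have key := content_mul_poincarePairing_ofRealForm_wedge_eq_orientationSign_mul_torusIntegral Φ hγ e hn h' y
  constructor
  · intro h0
    rw [h0, mul_zero] at key
    have hint : torusIntegral Φ ((finCongr h').trans e) ((wedgePow (ofRealForm η) (j + 1)).wedge y) = 0 := by
      rcases mul_eq_zero.1 key.symm with h | h
      · exact absurd h hs
      · exact h
    exact eq_of_torusIntegral_eq Φ ((finCongr h').trans e) (by rw [hint, torusIntegral_zero])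
  · intro h0
    rw [h0, torusIntegral_zero, mul_zero] at key
    rcases mul_eq_zero.1 key with h | h
    · exact absurd h hc
    · exact h

/-- **`sign_X(e) · ⟨θ, γ_{g−2} ∧ θ⟩_e = (−1)^g · g(g−1) · d_{g−1} · d_g`** (`g = j + 2`; any presentation, any orientation): the value of the
Lefschetz form of degree two on the polarisation itself — `(j!·d₁⋯d_j) · B₂(θ, θ) = sign · ∫_X θ^{∧g} = sign · (−1)^g g! · d₁⋯d_g`. For a
principal polarisation `B₂(θ, θ) = ±g(g−1)` (`θ² = ±2` on an abelian surface). [cite: Lange2023AbelianVarietiesComplex, §1.7.2 Lemma 1.7.5 (PDF p. 73); §2.5.3 Thm. 2.5.16 and Cor. 2.5.17 (PDF p. 135); §6.2.4 (PDF p. 310)] [cite: VoisinHodgeI2002, §6.3.2] -/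
theorem IsPolarizationType.orientationSign_mul_poincarePairing_ofRealForm_wedge_ofRealForm_of_eq_content_smul
    (hd : IsPolarizationType Φ η d) (hη : IsRiemannForm Φ η) (hle : j ≤ j + 2) {γ : E [⋀^Fin (2 * j)]→L[ℝ] ℂ}
    (hγ : wedgePow (ofRealForm η) j = ((j.factorial * ∏ i : Fin j, d (Fin.castLE hle i) : ℕ) : ℂ) • γ)
    (e : Fin n ≃ ι) (hn : 2 + (2 * j + 2) = n) :
    (orientationSign Φ e : ℂ) * poincarePairing Φ e hn (ofRealForm η) (γ.wedge (ofRealForm η : E [⋀^Fin 2]→L[ℝ] ℂ)) =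
      (-1) ^ j * (((j + 2) * (j + 1) * d (Fin.last j).castSucc * d (Fin.last (j + 1)) : ℕ) : ℂ) := by
  have h' : 2 * j + 2 + 2 = n := by omega
  have hc : ((j.factorial * ∏ i : Fin j, d (Fin.castLE hle i) : ℕ) : ℂ) ≠ 0 :=
    Nat.cast_ne_zero.2 (Nat.mul_ne_zero (Nat.factorial_ne_zero _) (Finset.prod_ne_zero_iff.2 fun i _ ↦ (hd.pos hη _).ne'))
  have hs : (orientationSign Φ e : ℂ) * orientationSign Φ e = 1 := by
    exact_mod_cast orientationSign_mul_self Φ e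
  have key := content_mul_poincarePairing_ofRealForm_wedge_eq_orientationSign_mul_torusIntegral Φ hγ e hn h'
    (ofRealForm η : E [⋀^Fin 2]→L[ℝ] ℂ)
  have hvol : torusIntegral Φ ((finCongr h').trans e)
      ((wedgePow (ofRealForm η) (j + 1)).wedge (ofRealForm η : E [⋀^Fin 2]→L[ℝ] ℂ)) =
      (-1) ^ (j + 2) * ((j + 2).factorial : ℂ) * ∏ i, (d i : ℂ) :=
    hη.torusIntegral_wedgePow_of_isPolarizationType Φ hd ((finCongr h').trans e)
  rw [hvol, prod_univ_eq_prod_castLE_mul_mul₅₈ d hle, Nat.factorial_succ, Nat.factorial_succ] at key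
  -- cancel the content `j!·d₁⋯d_j`
  refine mul_left_cancel₀ hc ?_
  calc ((j.factorial * ∏ i : Fin j, d (Fin.castLE hle i) : ℕ) : ℂ) *
        ((orientationSign Φ e : ℂ) * poincarePairing Φ e hn (ofRealForm η) (γ.wedge (ofRealForm η : E [⋀^Fin 2]→L[ℝ] ℂ)))
      = orientationSign Φ e * (((j.factorial * ∏ i : Fin j, d (Fin.castLE hle i) : ℕ) : ℂ) *
          poincarePairing Φ e hn (ofRealForm η) (γ.wedge (ofRealForm η : E [⋀^Fin 2]→L[ℝ] ℂ))) := by ring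
    _ = orientationSign Φ e * (orientationSign Φ e * ((-1) ^ (j + 2) * (((j + 1 + 1) * ((j + 1) * j.factorial) : ℕ) : ℂ) *
          ((∏ i : Fin j, (d (Fin.castLE hle i) : ℂ)) * d (Fin.last j).castSucc * d (Fin.last (j + 1))))) := by rw [key]
    _ = _ := by
      rw [← mul_assoc, hs, one_mul]
      push_cast
      ring

/-- **`⟨θ, γ_{g−2} ∧ θ⟩_e ≠ 0`**: the polarisation is not `B₂`-isotropic; equivalently `θ ∉ P²(X, ℤ)` and `θ^{∧g} ≠ 0`.
[cite: Lange2023AbelianVarietiesComplex, §1.7.2 Lemma 1.7.5 (PDF p. 73)] -/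
theorem IsPolarizationType.poincarePairing_ofRealForm_wedge_ofRealForm_ne_zero_of_eq_content_smul (hd : IsPolarizationType Φ η d)
    (hη : IsRiemannForm Φ η) (hle : j ≤ j + 2) {γ : E [⋀^Fin (2 * j)]→L[ℝ] ℂ}
    (hγ : wedgePow (ofRealForm η) j = ((j.factorial * ∏ i : Fin j, d (Fin.castLE hle i) : ℕ) : ℂ) • γ)
    (e : Fin n ≃ ι) (hn : 2 + (2 * j + 2) = n) :
    poincarePairing Φ e hn (ofRealForm η) (γ.wedge (ofRealForm η : E [⋀^Fin 2]→L[ℝ] ℂ)) ≠ 0 := fun h0 ↦ by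
  have key := hd.orientationSign_mul_poincarePairing_ofRealForm_wedge_ofRealForm_of_eq_content_smul hη hle hγ e hn
  rw [h0, mul_zero] at key
  have hne : ((-1 : ℂ) ^ j * (((j + 2) * (j + 1) * d (Fin.last j).castSucc * d (Fin.last (j + 1)) : ℕ) : ℂ)) ≠ 0 :=
    mul_ne_zero (pow_ne_zero _ (neg_ne_zero.2 one_ne_zero)) (Nat.cast_ne_zero.2 (Nat.mul_ne_zero
      (Nat.mul_ne_zero (Nat.mul_ne_zero (by omega) (by omega)) (hd.pos hη _).ne') (hd.pos hη _).ne'))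
  exact hne key.symm

/-- **`θ^{∧g} ≠ 0`, i.e. `θ ∉ P²(X, ℤ)`** (`g = j + 2`): `θ^{∧(g−1)} ∧ θ ≠ 0`. [cite: Lange2023AbelianVarietiesComplex, §1.7.2 Lemma 1.7.5 (PDF p. 73)] -/
theorem IsPolarizationType.wedgePow_wedge_ofRealForm_ne_zero (hd : IsPolarizationType Φ η d) (hη : IsRiemannForm Φ η)
    (e : Fin n ≃ ι) (hn : 2 + (2 * j + 2) = n) :
    (wedgePow (ofRealForm η) (j + 1)).wedge (ofRealForm η : E [⋀^Fin 2]→L[ℝ] ℂ) ≠ 0 := by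
  obtain ⟨γ, -, hγ⟩ := hd.exists_mem_integralForms_wedgePow_eq_content_smul (Nat.le_add_right j 2)
  rw [Ne, ← hd.poincarePairing_ofRealForm_wedge_eq_zero_iff_of_eq_content_smul hη (Nat.le_add_right j 2) hγ e hn]
  exact hd.poincarePairing_ofRealForm_wedge_ofRealForm_ne_zero_of_eq_content_smul hη (Nat.le_add_right j 2) hγ e hn

/-- **`ℤθ ∩ P²(X, ℤ) = 0`**, indeed `a·θ ∈ ker(θ^{∧(g−1)} ∧ (−))` forces `a = 0` (`g = j + 2`). [cite: Lange2023AbelianVarietiesComplex, §5.4.1 (5.22) (PDF p. 275); §1.7.2 Lemma 1.7.5 (PDF p. 73)] -/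
theorem IsPolarizationType.eq_zero_of_wedgePow_wedge_smul_ofRealForm_eq_zero (hd : IsPolarizationType Φ η d) (hη : IsRiemannForm Φ η)
    (e : Fin n ≃ ι) (hn : 2 + (2 * j + 2) = n) {a : ℂ}
    (ha : (wedgePow (ofRealForm η) (j + 1)).wedge (a • (ofRealForm η : E [⋀^Fin 2]→L[ℝ] ℂ)) = 0) : a = 0 := by
  rw [wedge_smul_right_complex] at ha
  rcases eq_or_ne a 0 with h0 | h0
  · exact h0
  · exact absurd (smul_right_injective _ h0 (ha.trans (smul_zero a).symm)) (hd.wedgePow_wedge_ofRealForm_ne_zero hη e hn)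

end Orthogonal

/-! ## §2 The discriminant of `B₂` on the primitive lattice `P²(X, ℤ)` -/

section PrimitiveDiscriminant

variable {ι : Type*} [Fintype ι] [DecidableEq ι] {E : Type*} [NormedAddCommGroup E] [NormedSpace ℂ E]
  {Φ : (ι → ℝ) ≃L[ℝ] E} {j n : ℕ} {η : E [⋀^Fin 2]→L[ℝ] ℝ} {d : Fin (j + 2) → ℕ}

/-- **The discriminant of the Lefschetz form of degree two on the primitive lattice.** For a polarised complex torus `X` of type
`(d₁, …, d_g)` (`g = j + 2`, any presentation `Φ`, any orientation `e`), the minimal class `γ = γ_{g−2}`, `P²(X, ℤ) = H²(X, ℤ) ∩ ker(θ^{∧(g−1)} ∧ (−))`,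
EVERY `ℤ`-basis `c` of `P²(X, ℤ)` and its integer Gram matrix `G_P = (⟨c_i, γ ∧ c_{i'}⟩_e)`:

  `|det G_P| · d_{g−1} = g · d_g · ∏_{i=1}^{g−2} ((d_{g−1}/d_i)·(d_g/d_i))^{2g−1}`.

Proof: Huybrechts' (0.2) for the symmetric integral form `B₂` on the lattice `H²(X, ℤ)` and the sublattice `ℤθ`, whose `B₂`-orthogonal
complement is `P²(X, ℤ)` (§1): `B₂(θ, θ) · det G_P = [H²(X, ℤ) : ℤθ ⊕ P²(X, ℤ)]² · det G_{H²}`, with `[H² : ℤθ ⊕ P²] = g·d_g` (g40),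
`|det G_{H²}| = (g−1)·∏((d_{g−1}/d_i)(d_g/d_i))^{2g−1}` (g41-#1) and `|B₂(θ, θ)| = g(g−1)·d_{g−1}d_g` (§1).
[cite: Huybrechts2016K3, Ch. 14 §0.1 (0.1)–(0.2)] [cite: Lange2023AbelianVarietiesComplex, §5.4.1 Thm. 5.4.2 and (5.22) (PDF p. 275); §6.2.4 (PDF p. 310); §1.7.2 Lemma 1.7.5 (PDF p. 73)] [cite: VoisinHodgeI2002, §6.2.3 Cor. 6.26 (PDF p. 126); §6.3.2] [cite: ConwaySloane1999, Ch. 2 §2.4 (PDF p. 162)] -/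
theorem IsPolarizationType.natAbs_det_poincarePairing_wedge_integralPrimitive_two_mul_of_eq_content_smul
    (hd : IsPolarizationType Φ η d) (hη : IsRiemannForm Φ η) (hle : j ≤ j + 2) {γ : E [⋀^Fin (2 * j)]→L[ℝ] ℂ}
    (hγ : wedgePow (ofRealForm η) j = ((j.factorial * ∏ i : Fin j, d (Fin.castLE hle i) : ℕ) : ℂ) • γ)
    (e : Fin n ≃ ι) (hn : 2 + (2 * j + 2) = n) {κ : Type*} [Fintype κ] [DecidableEq κ]
    (c : Basis κ ℤ ↥(integralForms Φ 2 ⊓ (AddMonoidHom.mk'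
      (fun x : E [⋀^Fin 2]→L[ℝ] ℂ ↦ (wedgePow (ofRealForm η) (j + 1)).wedge x) (ContinuousAlternatingMap.wedge_add_right _)).ker))
    (GP : Matrix κ κ ℤ) (hGP : ∀ i i', (GP i i' : ℂ) =
      poincarePairing Φ e hn (c i : E [⋀^Fin 2]→L[ℝ] ℂ) (γ.wedge (c i' : E [⋀^Fin 2]→L[ℝ] ℂ))) :
    GP.det.natAbs * d (Fin.last j).castSucc =
      (j + 2) * d (Fin.last (j + 1)) * (∏ i : Fin j, (d (Fin.last j).castSucc / d (Fin.castLE hle i)) *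
        (d (Fin.last (j + 1)) / d (Fin.castLE hle i))) ^ (2 * j + 3) := by
  classical
  -- membership in the primitive lattice `P²(X, ℤ)`
  have hmemK : ∀ {x : E [⋀^Fin 2]→L[ℝ] ℂ}, x ∈ integralForms Φ 2 ⊓ (AddMonoidHom.mk'
      (fun x : E [⋀^Fin 2]→L[ℝ] ℂ ↦ (wedgePow (ofRealForm η) (j + 1)).wedge x) (ContinuousAlternatingMap.wedge_add_right _)).ker ↔
      x ∈ integralForms Φ 2 ∧ (wedgePow (ofRealForm η) (j + 1)).wedge x = 0 :=
    fun {x} ↦ by rw [AddSubgroup.mem_inf, AddMonoidHom.mem_ker]; rfl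
  have hθH : (ofRealForm η : E [⋀^Fin 2]→L[ℝ] ℂ) ∈ integralForms Φ 2 := ofRealForm_mem_integralForms_two Φ hη.isNSForm
  have hγZ : γ ∈ integralForms Φ (2 * j) := by
    obtain ⟨Φ', hΛ, hs⟩ := hd.exists_isSymplecticEnum Φ
    obtain ⟨γ', hγ'Z, hγ'⟩ := hd.exists_mem_integralForms_wedgePow_eq_content_smul hle
    rwa [hs.eq_of_wedgePow_eq_content_smul Φ' (hη.of_range_latticeVec_subset hΛ.le) hle hγ hγ']
  have hiff : ∀ y : E [⋀^Fin 2]→L[ℝ] ℂ, poincarePairing Φ e hn (ofRealForm η) (γ.wedge y) = 0 ↔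
      (wedgePow (ofRealForm η) (j + 1)).wedge y = 0 :=
    fun y ↦ hd.poincarePairing_ofRealForm_wedge_eq_zero_iff_of_eq_content_smul hη hle hγ e hn y
  -- `H²(X, ℤ)` is a finite free torsion-free `ℤ`-module, with the `ℤ`-basis of increasing lattice monomials
  letI : LinearOrder ι := linearOrderOfOrientation e
  let bH : Basis {w : Fin 2 → ι // StrictMono w} ℤ ↥(integralForms Φ 2) := intLatMonomialBasis Φ 2
  haveI : Module.Free ℤ ↥(integralForms Φ 2) := Module.Free.of_basis bH
  haveI : Module.Finite ℤ ↥(integralForms Φ 2) := Module.Finite.of_basis bH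
  haveI : IsAddTorsionFree (E [⋀^Fin 2]→L[ℝ] ℂ) := IsAddTorsionFree.of_isTorsionFree ℂ _
  haveI : IsTorsionFree ℤ ↥(integralForms Φ 2) := Function.Injective.moduleIsTorsionFree
    (Subtype.val : ↥(integralForms Φ 2) → E [⋀^Fin 2]→L[ℝ] ℂ) Subtype.val_injective fun _ _ ↦ rfl
  -- the integral Lefschetz form `B₂(x, y) = ⟨x, γ ∧ y⟩` as a symmetric `ℤ`-bilinear form on `H²(X, ℤ)`
  obtain ⟨P, hP⟩ := exists_pairing_eq_poincarePairing Φ e hn (k := 2) (l := 2 * j + 2)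
  let Lγ : ↥(integralForms Φ 2) →ₗ[ℤ] ↥(integralForms Φ (2 * j + 2)) :=
    (((AddMonoidHom.mk' (fun x : E [⋀^Fin 2]→L[ℝ] ℂ ↦ γ.wedge x) (ContinuousAlternatingMap.wedge_add_right _)).comp
      (integralForms Φ 2).subtype).codRestrict (integralForms Φ (2 * j + 2)) fun x ↦ wedge_mem_integralForms Φ hγZ x.2).toIntLinearMap
  have hLγ : ∀ x : ↥(integralForms Φ 2), (Lγ x : E [⋀^Fin (2 * j + 2)]→L[ℝ] ℂ) = γ.wedge (x : E [⋀^Fin 2]→L[ℝ] ℂ) := fun _ ↦ rfl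
  let B : BilinForm ℤ ↥(integralForms Φ 2) := P.compl₂ Lγ
  have hB : ∀ x y : ↥(integralForms Φ 2),
      ((B x y : ℤ) : ℂ) = poincarePairing Φ e hn (x : E [⋀^Fin 2]→L[ℝ] ℂ) (γ.wedge (y : E [⋀^Fin 2]→L[ℝ] ℂ)) :=
    fun x y ↦ by rw [LinearMap.compl₂_apply, hP, hLγ]
  have hBs : B.IsSymm := ⟨fun x y ↦ by
    apply Int.cast_injective (α := ℂ)
    rw [hB, hB, poincarePairing_wedge_comm_of_two]⟩
  -- the line `L = ℤθ` in `H²(X, ℤ)`, its basis, `B(θ, θ) ≠ 0`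
  let θ' : ↥(integralForms Φ 2) := ⟨ofRealForm η, hθH⟩
  have hBθ : ((B θ' θ' : ℤ) : ℂ) = poincarePairing Φ e hn (ofRealForm η) (γ.wedge (ofRealForm η : E [⋀^Fin 2]→L[ℝ] ℂ)) := hB θ' θ'
  have hBθ0 : B θ' θ' ≠ 0 := fun h ↦
    hd.poincarePairing_ofRealForm_wedge_ofRealForm_ne_zero_of_eq_content_smul hη hle hγ e hn (by rw [← hBθ, h, Int.cast_zero])
  have hθ'0 : θ' ≠ 0 := fun h ↦ hBθ0 (by rw [h]; exact LinearMap.map_zero₂ B 0)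
  have hli : LinearIndependent ℤ ![θ'] := linearIndependent_unique_iff.2 hθ'0
  let L : Submodule ℤ ↥(integralForms Φ 2) := Submodule.span ℤ (Set.range ![θ'])
  let bL : Basis (Fin 1) ℤ ↥L := Basis.span hli
  have hbL : ((bL default : ↥L) : ↥(integralForms Φ 2)) = θ' := by
    rw [Fin.default_eq_zero, Basis.coe_span_apply]; rfl
  have hθ'L : θ' ∈ L := Submodule.subset_span ⟨0, rfl⟩
  have hmemL : ∀ {x : ↥(integralForms Φ 2)}, x ∈ L ↔ ∃ a : ℤ, a • θ' = x := fun {x} ↦ by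
    rw [Submodule.mem_span_range_iff_exists_fun]
    constructor
    · rintro ⟨cf, rfl⟩
      exact ⟨cf 0, by rw [Fin.sum_univ_one]; rfl⟩
    · rintro ⟨a, rfl⟩
      exact ⟨fun _ ↦ a, by rw [Fin.sum_univ_one]; rfl⟩
  -- its `B₂`-orthogonal complement is the primitive lattice
  have hmemN : ∀ y : ↥(integralForms Φ 2), y ∈ B.orthogonal L ↔
      (wedgePow (ofRealForm η) (j + 1)).wedge (y : E [⋀^Fin 2]→L[ℝ] ℂ) = 0 := fun y ↦ by
    rw [LinearMap.BilinForm.mem_orthogonal_iff, ← hiff]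
    constructor
    · intro h
      have h1 : B θ' y = 0 := h θ' hθ'L
      have h2 := hB θ' y
      rw [h1, Int.cast_zero] at h2
      exact h2.symm
    · intro h x hx
      obtain ⟨a, rfl⟩ := hmemL.1 hx
      have h1 : B θ' y = 0 := by
        apply Int.cast_injective (α := ℂ)
        rw [hB, Int.cast_zero]
        exact h
      show B (a • θ') y = 0
      rw [LinearMap.BilinForm.smul_left, h1, mul_zero]
  -- `[H²(X, ℤ) : ℤθ ⊕ P²(X, ℤ)] = g·d_g`
  have hsub : (L ⊔ B.orthogonal L).toAddSubgroup =
      (AddSubgroup.zmultiples (ofRealForm η : E [⋀^Fin 2]→L[ℝ] ℂ) ⊔ (integralForms Φ 2 ⊓ (AddMonoidHom.mk'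
        (fun x : E [⋀^Fin 2]→L[ℝ] ℂ ↦ (wedgePow (ofRealForm η) (j + 1)).wedge x)
        (ContinuousAlternatingMap.wedge_add_right _)).ker)).addSubgroupOf (integralForms Φ 2) := by
    ext x
    simp only [Submodule.mem_toAddSubgroup, Submodule.mem_sup, AddSubgroup.mem_addSubgroupOf, AddSubgroup.mem_sup]
    constructor
    · rintro ⟨y, hy, z, hz, rfl⟩
      obtain ⟨a, rfl⟩ := hmemL.1 hy
      exact ⟨a • (ofRealForm η : E [⋀^Fin 2]→L[ℝ] ℂ), AddSubgroup.zsmul_mem _ (AddSubgroup.mem_zmultiples _) a,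
        (z : E [⋀^Fin 2]→L[ℝ] ℂ), hmemK.2 ⟨z.2, (hmemN z).1 hz⟩, rfl⟩
    · rintro ⟨a, ha, k, hk, hx⟩
      obtain ⟨m, rfl⟩ := AddSubgroup.mem_zmultiples_iff.1 ha
      obtain ⟨hkH, hkW⟩ := hmemK.1 hk
      exact ⟨m • θ', hmemL.2 ⟨m, rfl⟩, ⟨k, hkH⟩, (hmemN ⟨k, hkH⟩).2 hkW, Subtype.ext hx⟩
  have hidx : (L ⊔ B.orthogonal L).toAddSubgroup.index = (j + 2) * d (Fin.last (j + 1)) := by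
    rw [hsub]
    exact hd.relIndex_zmultiples_sup_integralPrimitive_two hη
  -- transport the basis `c` of `P²(X, ℤ)` to the orthogonal complement
  let eK : ↥(integralForms Φ 2 ⊓ (AddMonoidHom.mk' (fun x : E [⋀^Fin 2]→L[ℝ] ℂ ↦ (wedgePow (ofRealForm η) (j + 1)).wedge x)
      (ContinuousAlternatingMap.wedge_add_right _)).ker) ≃ₗ[ℤ] ↥(B.orthogonal L) :=
    { toFun := fun k ↦ ⟨⟨(k : E [⋀^Fin 2]→L[ℝ] ℂ), (hmemK.1 k.2).1⟩, (hmemN _).2 (hmemK.1 k.2).2⟩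
      invFun := fun z ↦ ⟨((z : ↥(integralForms Φ 2)) : E [⋀^Fin 2]→L[ℝ] ℂ),
        hmemK.2 ⟨(z : ↥(integralForms Φ 2)).2, (hmemN _).1 z.2⟩⟩
      left_inv := fun _ ↦ rfl
      right_inv := fun _ ↦ rfl
      map_add' := fun _ _ ↦ rfl
      map_smul' := fun _ _ ↦ rfl }
  let bN : Basis κ ℤ ↥(B.orthogonal L) := c.map eK
  have hbN : ∀ i, ((bN i : ↥(integralForms Φ 2)) : E [⋀^Fin 2]→L[ℝ] ℂ) = (c i : E [⋀^Fin 2]→L[ℝ] ℂ) := fun i ↦ by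
    rw [Basis.map_apply]; rfl
  -- the three Gram matrices
  have hGN : LinearMap.BilinForm.toMatrix bN (B.restrict (B.orthogonal L)) = GP := by
    ext i i'
    apply Int.cast_injective (α := ℂ)
    rw [LinearMap.BilinForm.toMatrix_apply, hGP, ← hbN, ← hbN]
    exact hB _ _
  have hGL : (LinearMap.BilinForm.toMatrix bL (B.restrict L)).det = B θ' θ' := by
    rw [Matrix.det_unique, LinearMap.BilinForm.toMatrix_apply, ← hbL]; rfl
  have hGH : (LinearMap.BilinForm.toMatrix bH B).det.natAbs = (j + 1) * (∏ i : Fin j, (d (Fin.last j).castSucc / d (Fin.castLE hle i)) *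
      (d (Fin.last (j + 1)) / d (Fin.castLE hle i))) ^ (2 * j + 3) :=
    hd.natAbs_det_poincarePairing_wedge_two_of_eq_content_smul hη hle hγ e hn bH _ fun i i' ↦ by
      rw [LinearMap.BilinForm.toMatrix_apply, hB]
  -- Huybrechts' (0.2): `B(θ, θ) · det G_P = [H² : ℤθ ⊕ P²]² · det G_{H²}`
  have h02 := LinearMap.BilinForm.det_mul_det_orthogonal_eq_index_sq_mul_of_det_ne_zero B L hBs bH bL bN
    (by rw [hGL]; exact hBθ0)
  rw [hGL, hGN, hidx] at h02
  have hnat : (B θ' θ').natAbs * GP.det.natAbs = ((j + 2) * d (Fin.last (j + 1))) ^ 2 * ((j + 1) *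
      (∏ i : Fin j, (d (Fin.last j).castSucc / d (Fin.castLE hle i)) * (d (Fin.last (j + 1)) / d (Fin.castLE hle i))) ^ (2 * j + 3)) := by
    have h1 := congrArg Int.natAbs h02
    rwa [Int.natAbs_mul, Int.natAbs_mul, Int.natAbs_pow, Int.natAbs_natCast, hGH] at h1
  -- `|B(θ, θ)| = g(g−1)·d_{g−1}d_g`
  have hsZ : (orientationSign Φ e).natAbs = 1 :=
    Int.isUnit_iff_natAbs_eq.1 (IsUnit.of_mul_eq_one _ (orientationSign_mul_self Φ e))
  have hBabs : (B θ' θ').natAbs = (j + 2) * (j + 1) * d (Fin.last j).castSucc * d (Fin.last (j + 1)) := by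
    have key := hd.orientationSign_mul_poincarePairing_ofRealForm_wedge_ofRealForm_of_eq_content_smul hη hle hγ e hn
    rw [← hBθ] at key
    have hZ : orientationSign Φ e * B θ' θ' = (-1) ^ j * (((j + 2) * (j + 1) * d (Fin.last j).castSucc * d (Fin.last (j + 1)) : ℕ) : ℤ) := by
      apply Int.cast_injective (α := ℂ)
      rw [Int.cast_mul, Int.cast_mul, Int.cast_pow, Int.cast_neg, Int.cast_one, Int.cast_natCast]
      exact key
    have h1 := congrArg Int.natAbs hZ
    rwa [Int.natAbs_mul, Int.natAbs_mul, Int.natAbs_pow, Int.natAbs_neg, Int.natAbs_one, one_pow, one_mul, Int.natAbs_natCast,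
      hsZ, one_mul] at h1
  rw [hBabs] at hnat
  -- cancel `(j+2)(j+1)·d_g`
  have hM : 0 < (j + 2) * (j + 1) * d (Fin.last (j + 1)) := Nat.mul_pos (Nat.mul_pos (by omega) (by omega)) (hd.pos hη _)
  refine Nat.eq_of_mul_eq_mul_left hM ?_
  calc (j + 2) * (j + 1) * d (Fin.last (j + 1)) * (GP.det.natAbs * d (Fin.last j).castSucc)
      = (j + 2) * (j + 1) * d (Fin.last j).castSucc * d (Fin.last (j + 1)) * GP.det.natAbs := by ring
    _ = ((j + 2) * d (Fin.last (j + 1))) ^ 2 * ((j + 1) * (∏ i : Fin j, (d (Fin.last j).castSucc / d (Fin.castLE hle i)) *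
          (d (Fin.last (j + 1)) / d (Fin.castLE hle i))) ^ (2 * j + 3)) := hnat
    _ = (j + 2) * (j + 1) * d (Fin.last (j + 1)) * ((j + 2) * d (Fin.last (j + 1)) *
          (∏ i : Fin j, (d (Fin.last j).castSucc / d (Fin.castLE hle i)) * (d (Fin.last (j + 1)) / d (Fin.castLE hle i))) ^ (2 * j + 3)) := by
      ring

/-- **Constant type `(k, …, k)`: `|disc B₂|_{P²(X, ℤ)}| = g`** (`g = j + 2`) — for every polarised complex torus of constant type, the minimal
class `γ_{g−2}` (`θ^{∧(g−2)} = ((g−2)!·k^{g−2})·γ_{g−2}`) and every `ℤ`-basis of the primitive lattice `P²(X, ℤ)`, the Gram matrix of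
`(x, y) ↦ ⟨x, γ_{g−2} ∧ y⟩` has `|det| = g`. [cite: Huybrechts2016K3, Ch. 14 §0.1 (0.2)] [cite: Lange2023AbelianVarietiesComplex, §5.4.1 (5.22) (PDF p. 275); §2.1.1] [cite: VoisinHodgeI2002, §6.2.3 Cor. 6.26 (PDF p. 126)] -/
theorem IsPolarizationType.natAbs_det_poincarePairing_wedge_integralPrimitive_two_of_eq_content_smul_of_forall_eq
    (hd : IsPolarizationType Φ η d) (hη : IsRiemannForm Φ η) (hle : j ≤ j + 2) {γ : E [⋀^Fin (2 * j)]→L[ℝ] ℂ}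
    (hγ : wedgePow (ofRealForm η) j = ((j.factorial * ∏ i : Fin j, d (Fin.castLE hle i) : ℕ) : ℂ) • γ) (hd₀ : ∀ i, d i = d 0)
    (e : Fin n ≃ ι) (hn : 2 + (2 * j + 2) = n) {κ : Type*} [Fintype κ] [DecidableEq κ]
    (c : Basis κ ℤ ↥(integralForms Φ 2 ⊓ (AddMonoidHom.mk'
      (fun x : E [⋀^Fin 2]→L[ℝ] ℂ ↦ (wedgePow (ofRealForm η) (j + 1)).wedge x) (ContinuousAlternatingMap.wedge_add_right _)).ker))
    (GP : Matrix κ κ ℤ) (hGP : ∀ i i', (GP i i' : ℂ) =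
      poincarePairing Φ e hn (c i : E [⋀^Fin 2]→L[ℝ] ℂ) (γ.wedge (c i' : E [⋀^Fin 2]→L[ℝ] ℂ))) :
    GP.det.natAbs = j + 2 := by
  have h := hd.natAbs_det_poincarePairing_wedge_integralPrimitive_two_mul_of_eq_content_smul hη hle hγ e hn c GP hGP
  simp only [hd₀, Nat.div_self (hd.pos hη 0), mul_one, Finset.prod_const_one, one_pow] at h
  exact Nat.eq_of_mul_eq_mul_right (hd.pos hη 0) h

/-- **THE type of a Riemann form: `|det G_P| · d_{g−1}(η) = g · d_g(η) · ∏_{i ≤ g−2} ((d_{g−1}(η)/d_i(η))(d_g(η)/d_i(η)))^{2g−1}`** for every `ℤ`-basis of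
`P²(X, ℤ)` (`|ι| = 2g`, `g = j + 2`, `IsRiemannForm.polarizationType` the elementary divisors of `E|_Λ`). [cite: Huybrechts2016K3, Ch. 14 §0.1 (0.2)] [cite: Lange2023AbelianVarietiesComplex, §1.5.1 (PDF p. 51); §5.4.1 (5.22) (PDF p. 275)] -/
theorem IsRiemannForm.natAbs_det_poincarePairing_wedge_integralPrimitive_two_mul_of_eq_content_smul (hη : IsRiemannForm Φ η)
    (hj : j + 2 = Fintype.card ι / 2) (hle : j ≤ j + 2) {γ : E [⋀^Fin (2 * j)]→L[ℝ] ℂ}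
    (hγ : wedgePow (ofRealForm η) j =
      ((j.factorial * ∏ i : Fin j, hη.polarizationType (Fin.cast hj (Fin.castLE hle i)) : ℕ) : ℂ) • γ)
    (e : Fin n ≃ ι) (hn : 2 + (2 * j + 2) = n) {κ : Type*} [Fintype κ] [DecidableEq κ]
    (c : Basis κ ℤ ↥(integralForms Φ 2 ⊓ (AddMonoidHom.mk'
      (fun x : E [⋀^Fin 2]→L[ℝ] ℂ ↦ (wedgePow (ofRealForm η) (j + 1)).wedge x) (ContinuousAlternatingMap.wedge_add_right _)).ker))
    (GP : Matrix κ κ ℤ) (hGP : ∀ i i', (GP i i' : ℂ) =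
      poincarePairing Φ e hn (c i : E [⋀^Fin 2]→L[ℝ] ℂ) (γ.wedge (c i' : E [⋀^Fin 2]→L[ℝ] ℂ))) :
    GP.det.natAbs * hη.polarizationType (Fin.cast hj (Fin.last j).castSucc) =
      (j + 2) * hη.polarizationType (Fin.cast hj (Fin.last (j + 1))) *
        (∏ i : Fin j, (hη.polarizationType (Fin.cast hj (Fin.last j).castSucc) / hη.polarizationType (Fin.cast hj (Fin.castLE hle i))) *
          (hη.polarizationType (Fin.cast hj (Fin.last (j + 1))) / hη.polarizationType (Fin.cast hj (Fin.castLE hle i)))) ^ (2 * j + 3) :=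
  (hη.isPolarizationType_polarizationType.comp_cast hj).natAbs_det_poincarePairing_wedge_integralPrimitive_two_mul_of_eq_content_smul
    hη hle hγ e hn c GP hGP

/-- **Principal polarisation: `|disc B₂|_{P²(X, ℤ)}| = g`** — for a principally polarised complex torus of dimension `g = j + 2`, the minimal
class `γ = θ^{∧(g−2)}/(g−2)!` and EVERY `ℤ`-basis `c` of the primitive lattice `P²(X, ℤ) = H²(X, ℤ) ∩ ker(θ^{∧(g−1)} ∧ (−))`, the integer Gram
matrix `(⟨c_i, γ ∧ c_{i'}⟩)` has `|det| = g`; `g = 2`: `|disc θ^⊥| = 2` in `H²(X, ℤ) ≅ U³` of a principally polarised abelian surface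
(`θ^⊥ ≅ U² ⊕ ⟨−2⟩`). [cite: Huybrechts2016K3, Ch. 14 §0.1 (0.2)] [cite: Lange2023AbelianVarietiesComplex, §5.4.1 (5.22) (PDF p. 275); §2.1.1] [cite: VoisinHodgeI2002, §6.2.3 Cor. 6.26 (PDF p. 126)] -/
theorem IsPrincipalPolarization.natAbs_det_poincarePairing_wedge_integralPrimitive_two_of_eq_factorial_smul
    (hp : IsPrincipalPolarization Φ η) {γ : E [⋀^Fin (2 * j)]→L[ℝ] ℂ} (hγ : wedgePow (ofRealForm η) j = (j.factorial : ℂ) • γ)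
    (e : Fin n ≃ ι) (hn : 2 + (2 * j + 2) = n) {κ : Type*} [Fintype κ] [DecidableEq κ]
    (c : Basis κ ℤ ↥(integralForms Φ 2 ⊓ (AddMonoidHom.mk'
      (fun x : E [⋀^Fin 2]→L[ℝ] ℂ ↦ (wedgePow (ofRealForm η) (j + 1)).wedge x) (ContinuousAlternatingMap.wedge_add_right _)).ker))
    (GP : Matrix κ κ ℤ) (hGP : ∀ i i', (GP i i' : ℂ) =
      poincarePairing Φ e hn (c i : E [⋀^Fin 2]→L[ℝ] ℂ) (γ.wedge (c i' : E [⋀^Fin 2]→L[ℝ] ℂ))) :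
    GP.det.natAbs = j + 2 := by
  obtain ⟨g, d', hd', h1⟩ := hp.exists_type_eq_one
  have hg : j + 2 = g := by
    have h₁ := hd'.card_eq
    have h₂ := Fintype.card_congr e
    rw [Fintype.card_fin] at h₂
    omega
  have hle : j ≤ j + 2 := Nat.le_add_right j 2
  have hγ' : wedgePow (ofRealForm η) j = ((j.factorial * ∏ i : Fin j, d' (Fin.cast hg (Fin.castLE hle i)) : ℕ) : ℂ) • γ := by
    simp only [h1, Finset.prod_const_one, mul_one]
    exact hγ
  exact (hd'.comp_cast hg).natAbs_det_poincarePairing_wedge_integralPrimitive_two_of_eq_content_smul_of_forall_eq hp.isRiemannForm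
    hle hγ' (fun i ↦ (h1 _).trans (h1 _).symm) e hn c GP hGP

end PrimitiveDiscriminant

end Literature.Geometry.Kaehler.ComplexTorus
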